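import Mathlib.Analysis.Normed.Field.Basic
import Mathlib.Analysis.Normed.Group.Ultra
import HarnessLib

/-!
# Route `IsogenyGlueCongruence`, crux `MazurKenkuBound` (stmt-ABC-15125) — line `Sketch`:
# stub `stub_flexNorms` (valuations on the flex model at `2`; pure ultrametric algebra)

Helper (`--supports stmt-ABC-15125`) of the line lead's skeleton. Over an ultrametric normed field
`F` with `‖2‖ = 1/2` and `‖3‖ = 1` (a `2`-adic field), let `A₁, A₃` be integral and put
`Δ = A₃³(A₁³ − 27A₃)`, `c₄ = A₁(A₁³ − 24A₃)` — the discriminant and the `c₄`-invariant of the flex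
model `y² + A₁xy + A₃y = x³`. If `Δ ≠ 0` and `‖c₄‖³ ≤ ‖Δ‖` (potentially good reduction,
`‖j‖ ≤ 1`), then

* `‖A₁‖¹² ≤ ‖Δ‖` and `‖A₃‖⁴ = ‖Δ‖`;
* if moreover `‖Δ‖ ≤ 2⁻¹⁶` and `‖c₄‖ ≥ 2⁻⁷`, then `‖A₁‖⁴ = ‖c₄‖`.

The proof is a case analysis on `X = ‖A₁‖³` versus `Y = ‖A₃‖ > 0` using only the ultrametric
inequality ("all triangles are isosceles"): `X > Y` would give `‖Δ‖ = Y³X` and `‖c₄‖³ = X⁴`,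
contradicting `‖c₄‖³ ≤ ‖Δ‖`; `X < Y` gives `‖A₁³ − 27A₃‖ = Y`; and for `X = Y` a strict drop
`‖A₁³ − 27A₃‖ < Y` would force `‖A₁³ − 24A₃‖ = ‖3A₃‖ = Y`, `‖c₄‖³ = Y⁴ > ‖Δ‖`, again a
contradiction. For the second part, `Y⁴ = ‖Δ‖ ≤ 2⁻¹⁶` gives `Y ≤ 2⁻⁴`, so `‖24A₃‖ ≤ 2⁻⁷`; if
`‖A₁³‖ ≤ ‖24A₃‖` then `2⁻⁷ ≤ ‖c₄‖ ≤ ‖A₁‖·2⁻⁷` forces `‖A₁‖ = 1 ≤ 2⁻⁷`, absurd; hence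
`‖A₁³ − 24A₃‖ = ‖A₁‖³` and `‖c₄‖ = ‖A₁‖⁴`.

## References

* J. H. Silverman, *The Arithmetic of Elliptic Curves*, 2nd ed. (2009), III.1 (the invariants
  `c₄`, `Δ` of a Weierstrass model) and VII.5.5 (potentially good reduction iff `j` integral).
  [SilvermanAEC2009]
-/

-- `Summit.<Summit>.<Problem>` is the mandated summit-side namespace (CONVENTIONS §2); for the
-- single-conjunct summit `ABC` the two coincide, so the duplicate `ABC.ABC` is deliberate.
set_option linter.dupNamespace false

noncomputable section

namespace Summit.ABC.ABC.Theorems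

section Ultrametric

variable {F : Type*} [NormedField F] [IsUltrametricDist F]

/-- In an ultrametric normed field, `‖y‖ < ‖x‖` forces `‖x - y‖ = ‖x‖`. [folklore] -/
private theorem flexNorms_norm_sub_eq_left {x y : F} (h : ‖y‖ < ‖x‖) : ‖x - y‖ = ‖x‖ := by
  rw [sub_eq_add_neg,
    IsUltrametricDist.norm_add_eq_max_of_norm_ne_norm (by rw [norm_neg]; exact h.ne'), norm_neg,
    max_eq_left h.le]

/-- In an ultrametric normed field, `‖x‖ < ‖y‖` forces `‖x - y‖ = ‖y‖`. [folklore] -/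
private theorem flexNorms_norm_sub_eq_right {x y : F} (h : ‖x‖ < ‖y‖) : ‖x - y‖ = ‖y‖ := by
  rw [sub_eq_add_neg,
    IsUltrametricDist.norm_add_eq_max_of_norm_ne_norm (by rw [norm_neg]; exact h.ne), norm_neg,
    max_eq_right h.le]

/-- The ultrametric inequality for a difference: `‖x - y‖ ≤ max ‖x‖ ‖y‖`. [folklore] -/
private theorem flexNorms_norm_sub_le_max (x y : F) : ‖x - y‖ ≤ max ‖x‖ ‖y‖ := by
  rw [sub_eq_add_neg, ← norm_neg y]
  exact IsUltrametricDist.norm_add_le_max x (-y)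

end Ultrametric

/-- **Valuations on the flex model at `2`.** In an ultrametric normed field with `‖2‖ = 1/2`,
`‖3‖ = 1`, for integral `A₁, A₃` put `Δ = A₃³(A₁³ − 27A₃) ≠ 0` and `c₄ = A₁(A₁³ − 24A₃)` (the
invariants of `y² + A₁xy + A₃y = x³`). If `‖c₄‖³ ≤ ‖Δ‖` (potentially good reduction) then
`‖A₁‖¹² ≤ ‖Δ‖` and `‖A₃‖⁴ = ‖Δ‖`; and if moreover `‖Δ‖ ≤ 2⁻¹⁶` and `‖c₄‖ ≥ 2⁻⁷` then
`‖A₁‖⁴ = ‖c₄‖`. Case analysis on `‖A₁‖³` versus `‖A₃‖` with the isosceles principle; see the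
module docstring. [folklore] [cite: SilvermanAEC2009, VII.5.5] -/
theorem stub_flexNorms :
    ∀ {F : Type*} [NormedField F] [IsUltrametricDist F], ‖(2 : F)‖ = 2⁻¹ → ‖(3 : F)‖ = 1 →
      ∀ (A₁ A₃ : F), ‖A₁‖ ≤ 1 → ‖A₃‖ ≤ 1 → A₃ ^ 3 * (A₁ ^ 3 - 27 * A₃) ≠ 0 →
      ‖A₁ * (A₁ ^ 3 - 24 * A₃)‖ ^ 3 ≤ ‖A₃ ^ 3 * (A₁ ^ 3 - 27 * A₃)‖ →
      (‖A₁‖ ^ 12 ≤ ‖A₃ ^ 3 * (A₁ ^ 3 - 27 * A₃)‖ ∧ ‖A₃‖ ^ 4 = ‖A₃ ^ 3 * (A₁ ^ 3 - 27 * A₃)‖) ∧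
      (‖A₃ ^ 3 * (A₁ ^ 3 - 27 * A₃)‖ ≤ 2⁻¹ ^ 16 → 2⁻¹ ^ 7 ≤ ‖A₁ * (A₁ ^ 3 - 24 * A₃)‖ →
        ‖A₁‖ ^ 4 = ‖A₁ * (A₁ ^ 3 - 24 * A₃)‖) := by
  intro F _ _ h2 h3 A₁ A₃ hA₁ _hA₃ hΔ hj
  -- the numerals `27 = 3³` and `24 = 2³·3`
  have h27 : ‖(27 : F)‖ = 1 := by
    rw [show (27 : F) = 3 ^ 3 by norm_num, norm_pow, h3, one_pow]
  have h24 : ‖(24 : F)‖ = 2⁻¹ ^ 3 := by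
    rw [show (24 : F) = 2 ^ 3 * 3 by norm_num, norm_mul, norm_pow, h2, h3, mul_one]
  -- `Y = ‖A₃‖ > 0`, `X = ‖A₁‖³ ≥ 0`
  have hA₃0 : A₃ ≠ 0 := by
    rintro rfl
    exact hΔ (by simp)
  have hY : 0 < ‖A₃‖ := norm_pos_iff.mpr hA₃0
  have hX0 : 0 ≤ ‖A₁‖ ^ 3 := pow_nonneg (norm_nonneg _) 3
  have hA13 : ‖A₁ ^ 3‖ = ‖A₁‖ ^ 3 := norm_pow A₁ 3
  have h27A : ‖27 * A₃‖ = ‖A₃‖ := by rw [norm_mul, h27, one_mul]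
  have h24A : ‖24 * A₃‖ = 2⁻¹ ^ 3 * ‖A₃‖ := by rw [norm_mul, h24]
  have h3A : ‖3 * A₃‖ = ‖A₃‖ := by rw [norm_mul, h3, one_mul]
  have hΔn : ‖A₃ ^ 3 * (A₁ ^ 3 - 27 * A₃)‖ = ‖A₃‖ ^ 3 * ‖A₁ ^ 3 - 27 * A₃‖ := by
    rw [norm_mul, norm_pow]
  have hc₄n : ‖A₁ * (A₁ ^ 3 - 24 * A₃)‖ = ‖A₁‖ * ‖A₁ ^ 3 - 24 * A₃‖ := norm_mul _ _
  have hN_le : ‖A₁ ^ 3 - 27 * A₃‖ ≤ max (‖A₁‖ ^ 3) ‖A₃‖ := by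
    have := flexNorms_norm_sub_le_max (A₁ ^ 3) (27 * A₃)
    rwa [hA13, h27A] at this
  have h24A_lt : ‖24 * A₃‖ < ‖A₃‖ := by
    rw [h24A]
    have h8 : (2⁻¹ : ℝ) ^ 3 < 1 := by norm_num
    calc 2⁻¹ ^ 3 * ‖A₃‖ < 1 * ‖A₃‖ := mul_lt_mul_of_pos_right h8 hY
      _ = ‖A₃‖ := one_mul _
  -- Step A: `X ≤ Y` (the case `X > Y` contradicts potential goodness)
  have hXY : ‖A₁‖ ^ 3 ≤ ‖A₃‖ := by
    by_contra hlt
    rw [not_le] at hlt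
    have hN : ‖A₁ ^ 3 - 27 * A₃‖ = ‖A₁‖ ^ 3 := by
      rw [← hA13]
      exact flexNorms_norm_sub_eq_left (by rw [hA13, h27A]; exact hlt)
    have hM : ‖A₁ ^ 3 - 24 * A₃‖ = ‖A₁‖ ^ 3 := by
      rw [← hA13]
      exact flexNorms_norm_sub_eq_left (by rw [hA13]; exact h24A_lt.trans hlt)
    rw [hΔn, hN, hc₄n, hM, mul_pow] at hj
    -- `hj : ‖A₁‖³ (‖A₁‖³)³ ≤ ‖A₃‖³ ‖A₁‖³`
    have hXpos : 0 < ‖A₁‖ ^ 3 := hY.trans hlt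
    have h3le : (‖A₁‖ ^ 3) ^ 3 ≤ ‖A₃‖ ^ 3 :=
      le_of_mul_le_mul_left (by rwa [mul_comm (‖A₃‖ ^ 3) (‖A₁‖ ^ 3)] at hj) hXpos
    have hle : ‖A₁‖ ^ 3 ≤ ‖A₃‖ := (pow_le_pow_iff_left₀ hX0 hY.le (by norm_num)).mp h3le
    exact absurd hle (not_le.mpr hlt)
  -- Step B: `‖A₁³ − 27A₃‖ = Y`
  have hN : ‖A₁ ^ 3 - 27 * A₃‖ = ‖A₃‖ := by
    rcases hXY.lt_or_eq with hlt | heq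
    · rw [← h27A]
      exact flexNorms_norm_sub_eq_right (by rw [hA13, h27A]; exact hlt)
    · have hle : ‖A₁ ^ 3 - 27 * A₃‖ ≤ ‖A₃‖ := by rwa [heq, max_self] at hN_le
      by_contra hne
      have hlt : ‖A₁ ^ 3 - 27 * A₃‖ < ‖A₃‖ := lt_of_le_of_ne hle hne
      have hM : ‖A₁ ^ 3 - 24 * A₃‖ = ‖A₃‖ := by
        have hsplit : A₁ ^ 3 - 24 * A₃ = 3 * A₃ - (-(A₁ ^ 3 - 27 * A₃)) := by ring
        rw [hsplit, ← h3A]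
        exact flexNorms_norm_sub_eq_left (by rw [norm_neg, h3A]; exact hlt)
      rw [hΔn, hc₄n, hM, mul_pow, heq] at hj
      -- `hj : ‖A₃‖ ‖A₃‖³ ≤ ‖A₃‖³ ‖A₁³ − 27A₃‖`
      have hY3 : 0 < ‖A₃‖ ^ 3 := pow_pos hY 3
      have hge : ‖A₃‖ ≤ ‖A₁ ^ 3 - 27 * A₃‖ :=
        le_of_mul_le_mul_left (by rwa [mul_comm ‖A₃‖ (‖A₃‖ ^ 3)] at hj) hY3
      exact absurd hge (not_le.mpr hlt)
  have hΔY : ‖A₃ ^ 3 * (A₁ ^ 3 - 27 * A₃)‖ = ‖A₃‖ ^ 4 := by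
    rw [hΔn, hN]; ring
  refine ⟨⟨?_, hΔY.symm⟩, ?_⟩
  · -- `‖A₁‖¹² = X⁴ ≤ Y⁴ = ‖Δ‖`
    rw [hΔY, show ‖A₁‖ ^ 12 = (‖A₁‖ ^ 3) ^ 4 by ring]
    exact pow_le_pow_left₀ hX0 hXY 4
  · intro hΔ16 hc₄7
    -- `Y ≤ 2⁻⁴`, so `‖24A₃‖ ≤ 2⁻⁷`
    have hY4 : ‖A₃‖ ≤ 2⁻¹ ^ 4 := by
      rw [hΔY, show ((2 : ℝ)⁻¹) ^ 16 = (2⁻¹ ^ 4) ^ 4 by norm_num] at hΔ16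
      exact (pow_le_pow_iff_left₀ hY.le (by norm_num) (by norm_num)).mp hΔ16
    have h24A7 : ‖24 * A₃‖ ≤ 2⁻¹ ^ 7 := by
      rw [h24A]
      calc (2 : ℝ)⁻¹ ^ 3 * ‖A₃‖ ≤ 2⁻¹ ^ 3 * 2⁻¹ ^ 4 := by gcongr
        _ = 2⁻¹ ^ 7 := by norm_num
    -- `‖24A₃‖ < ‖A₁‖³`, else `‖c₄‖ ≤ ‖A₁‖·2⁻⁷` forces `‖A₁‖ = 1 ≤ 2⁻⁷`
    have hXgt : ‖24 * A₃‖ < ‖A₁‖ ^ 3 := by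
      by_contra hle
      rw [not_lt] at hle
      have hM : ‖A₁ ^ 3 - 24 * A₃‖ ≤ 2⁻¹ ^ 7 :=
        calc ‖A₁ ^ 3 - 24 * A₃‖ ≤ max ‖A₁ ^ 3‖ ‖24 * A₃‖ := flexNorms_norm_sub_le_max _ _
          _ = ‖24 * A₃‖ := max_eq_right (by rw [hA13]; exact hle)
          _ ≤ 2⁻¹ ^ 7 := h24A7
      rw [hc₄n] at hc₄7
      have hA₁1 : 1 ≤ ‖A₁‖ := by
        by_contra hlt1
        rw [not_le] at hlt1
        have hlt : ‖A₁‖ * ‖A₁ ^ 3 - 24 * A₃‖ < 2⁻¹ ^ 7 :=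
          calc ‖A₁‖ * ‖A₁ ^ 3 - 24 * A₃‖ ≤ ‖A₁‖ * 2⁻¹ ^ 7 := by gcongr
            _ < 1 * 2⁻¹ ^ 7 := mul_lt_mul_of_pos_right hlt1 (by norm_num)
            _ = 2⁻¹ ^ 7 := one_mul _
        exact absurd hc₄7 (not_le.mpr hlt)
      have hX1 : ‖A₁‖ ^ 3 = 1 := by rw [le_antisymm hA₁ hA₁1, one_pow]
      rw [hX1] at hle
      have h7 : ((2 : ℝ)⁻¹) ^ 7 < 1 := by norm_num
      exact absurd (hle.trans h24A7) (not_le.mpr h7)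
    have hM : ‖A₁ ^ 3 - 24 * A₃‖ = ‖A₁‖ ^ 3 := by
      rw [← hA13]
      exact flexNorms_norm_sub_eq_left (by rw [hA13]; exact hXgt)
    rw [hc₄n, hM]
    ring

end Summit.ABC.ABC.Theorems
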